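import Summits.Ventures.PercRepro.S2SquareMultiplicity

/-!
# PercRepro — S2: THE SQUARE MULTIPLICITY SHARPENED — `ν + 3·C(ν, 2)` spanning subsets under `lines ≤ 3 points`
(p7, gen 2; sub-claim S2)

`S2SquareMultiplicity` counts, for a rank-`q` set `B` with `m = q + ν` elements, `ν` spanning `(q+1)`-subsets `I ∪ {x}`
and, for each pair `{x, y}` of elements outside a basis `I`, at least `2` sets `(I ∖ {z}) ∪ {x, y}` (`z ∈ I` on a
fundamental circuit of `x` or `y`). When every rank-`2` set has `≤ 3` points there are at least `3` such `z` per pair: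
if `I ∩ (C(x) ∪ C(y))` had only two elements `a, b`, then `C(x) = {x, a, b}` and `C(y) = {y, a, b}`, and `{a, b, x, y}`
would be a `4`-point line. Hence `#spanF ≥ ν + 3·C(ν, 2) = ν(3ν − 1)/2` (`card_spanF_ge_three`), and the fibre weights
of the giant-flat count become `2/((j + 1)(3j + 2))` (`S2SquareGiantCount3`). Axioms: standard.
-/

open scoped Matroid

namespace PercRepro

namespace S2

open Set Finset

variable {α : Type} {M : Matroid α}

open scoped Classical in
/-- **Three exchange points per pair** (lines `≤ 3` points): for `x ≠ y` outside an independent set `I` with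
`x, y ∈ cl(I)`, the elements of `I` on `C(x) ∪ C(y)` number at least `3`. -/
theorem three_le_card_filter_pair [M.Finite] (hcirc : ∀ C, M.IsCircuit C → 3 ≤ C.encard)
    (hC1 : ∀ L ⊆ M.E, M.eRk L = 2 → L.ncard ≤ 3)
    {I : Finset α} (hI : M.Indep (I : Set α)) (hIE : (I : Set α) ⊆ M.E)
    {x y : α} (hxcl : x ∈ M.closure (I : Set α)) (hxI : x ∉ I) (hycl : y ∈ M.closure (I : Set α)) (hyI : y ∉ I)
    (hxy : x ≠ y) (hxE : x ∈ M.E) (hyE : y ∈ M.E) :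
    3 ≤ (I.filter (fun z => z ∈ M.fundCircuit x (I : Set α) ∨ z ∈ M.fundCircuit y (I : Set α))).card := by
  classical
  set Fx := I.filter (fun z => z ∈ M.fundCircuit x (I : Set α)) with hFx
  set Fy := I.filter (fun z => z ∈ M.fundCircuit y (I : Set α)) with hFy
  have hx2 : 2 ≤ Fx.card := two_le_card_filter_fundCircuit hcirc hI hxcl hxI
  have hy2 : 2 ≤ Fy.card := two_le_card_filter_fundCircuit hcirc hI hycl hyI
  have hunion : I.filter (fun z => z ∈ M.fundCircuit x (I : Set α) ∨ z ∈ M.fundCircuit y (I : Set α)) = Fx ∪ Fy := by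
    rw [hFx, hFy, Finset.filter_or]
  rw [hunion]
  by_contra hlt
  push Not at hlt
  -- then `Fx = Fy`, both of two elements
  have hsub : Fx ⊆ Fx ∪ Fy := Finset.subset_union_left
  have hsub' : Fy ⊆ Fx ∪ Fy := Finset.subset_union_right
  have hcu : (Fx ∪ Fy).card ≤ 2 := by omega
  have hc1 := Finset.card_le_card hsub
  have hc2 := Finset.card_le_card hsub'
  have hFxeq : Fx = Fx ∪ Fy := Finset.eq_of_subset_of_card_le hsub (by omega)
  have hFyeq : Fy = Fx ∪ Fy := Finset.eq_of_subset_of_card_le hsub' (by omega)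
  have hFxy : Fx = Fy := hFxeq.trans hFyeq.symm
  have hFx2 : Fx.card = 2 := by omega
  -- `C(x) = {x} ∪ Fx`, `C(y) = {y} ∪ Fy`
  have hCx : M.IsCircuit (M.fundCircuit x (I : Set α)) := hI.fundCircuit_isCircuit hxcl (by simpa using hxI)
  have hCy : M.IsCircuit (M.fundCircuit y (I : Set α)) := hI.fundCircuit_isCircuit hycl (by simpa using hyI)
  have hCxsub : M.fundCircuit x (I : Set α) ⊆ insert x (I : Set α) := M.fundCircuit_subset_insert x _
  have hCysub : M.fundCircuit y (I : Set α) ⊆ insert y (I : Set α) := M.fundCircuit_subset_insert y _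
  have hCxeq : M.fundCircuit x (I : Set α) = insert x (Fx : Set α) := by
    ext z
    constructor
    · intro hz
      rcases hCxsub hz with h | h
      · exact Or.inl h
      · exact Or.inr (by rw [Finset.mem_coe, hFx, Finset.mem_filter]; exact ⟨by exact_mod_cast h, hz⟩)
    · rintro (h | h)
      · rw [h]; exact M.mem_fundCircuit x _
      · rw [Finset.mem_coe, hFx, Finset.mem_filter] at h; exact h.2
  have hCyeq : M.fundCircuit y (I : Set α) = insert y (Fy : Set α) := by
    ext z
    constructor
    · intro hz
      rcases hCysub hz with h | h
      · exact Or.inl h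
      · exact Or.inr (by rw [Finset.mem_coe, hFy, Finset.mem_filter]; exact ⟨by exact_mod_cast h, hz⟩)
    · rintro (h | h)
      · rw [h]; exact M.mem_fundCircuit y _
      · rw [Finset.mem_coe, hFy, Finset.mem_filter] at h; exact h.2
  -- `x, y ∈ cl(Fx)`: a circuit lies in the closure of its other elements
  have hxFx : x ∈ M.closure (Fx : Set α) := by
    have h := hCx.mem_closure_sdiff_singleton_of_mem (M.mem_fundCircuit x _)
    rw [hCxeq, Set.insert_sdiff_of_mem _ (Set.mem_singleton x), Set.sdiff_singleton_eq_self (by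
      intro hx; rw [Finset.mem_coe, hFx, Finset.mem_filter] at hx; exact hxI hx.1)] at h
    exact h
  have hyFx : y ∈ M.closure (Fx : Set α) := by
    have h := hCy.mem_closure_sdiff_singleton_of_mem (M.mem_fundCircuit y _)
    rw [hCyeq, Set.insert_sdiff_of_mem _ (Set.mem_singleton y), Set.sdiff_singleton_eq_self (by
      intro hy; rw [Finset.mem_coe, hFy, Finset.mem_filter] at hy; exact hyI hy.1), ← hFxy] at h
    exact h
  -- the four points `x, y, Fx` lie in a rank-`2` set
  have hFxI : (Fx : Set α) ⊆ (I : Set α) := by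
    intro z hz; rw [Finset.mem_coe, hFx, Finset.mem_filter] at hz; exact_mod_cast hz.1
  have hFxE : (Fx : Set α) ⊆ M.E := hFxI.trans hIE
  have hFxind : M.Indep (Fx : Set α) := hI.subset hFxI
  have hFxrk : M.eRk (Fx : Set α) = 2 := by
    rw [hFxind.eRk_eq_encard, Set.encard_coe_eq_coe_finsetCard, hFx2]; rfl
  set L : Set α := insert x (insert y (Fx : Set α)) with hL
  have hLE : L ⊆ M.E := by
    intro z hz
    rcases hz with h | h | h
    · rw [h]; exact hxE
    · rw [h]; exact hyE
    · exact hFxE h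
  have hLcl : L ⊆ M.closure (Fx : Set α) := by
    intro z hz
    rcases hz with h | h | h
    · rw [h]; exact hxFx
    · rw [h]; exact hyFx
    · exact M.subset_closure _ hFxE h
  have hLrk : M.eRk L = 2 := by
    apply le_antisymm
    · calc M.eRk L ≤ M.eRk (M.closure (Fx : Set α)) := M.eRk_mono hLcl
        _ = 2 := by rw [M.eRk_closure_eq, hFxrk]
    · rw [← hFxrk]
      exact M.eRk_mono (fun z hz => Or.inr (Or.inr hz))
  have hL3 := hC1 L hLE hLrk
  have hxFx' : x ∉ (Fx : Set α) := fun h => hxI (hFxI h)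
  have hyFx' : y ∉ (Fx : Set α) := fun h => hyI (hFxI h)
  have hxins : x ∉ insert y (Fx : Set α) := by
    intro h; rcases h with h | h
    · exact hxy h
    · exact hxFx' h
  have hLcard : L.ncard = 4 := by
    rw [hL, Set.ncard_insert_of_notMem hxins (Set.toFinite _), Set.ncard_insert_of_notMem hyFx' (Finset.finite_toSet _),
      Set.ncard_coe_finset, hFx2]
  omega

/-- **THE SQUARE, SHARPENED**: a rank-`q` set `B` of `m = q + ν` elements (every circuit of `≥ 3` elements, every
rank-`2` set of `≤ 3` points) has at least `ν + 3·C(ν, 2)` spanning `(q+1)`-subsets. -/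
theorem card_spanF_ge_three [M.Finite] (q : ℕ) (hq : 1 ≤ q) (hcirc : ∀ C, M.IsCircuit C → 3 ≤ C.encard)
    (hC1 : ∀ L ⊆ M.E, M.eRk L = 2 → L.ncard ≤ 3)
    {B : Finset α} (hBE : (B : Set α) ⊆ M.E) (hBq : M.eRk (B : Set α) = (q : ℕ∞)) :
    (B.card - q) + 3 * (B.card - q).choose 2 ≤ (spanF M q B).card := by
  classical
  obtain ⟨I₀, hI₀⟩ := M.exists_isBasis (B : Set α) hBE
  have hI₀fin : I₀.Finite := B.finite_toSet.subset hI₀.subset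
  set I : Finset α := hI₀fin.toFinset with hIdef
  have hIcoe : (I : Set α) = I₀ := Set.Finite.coe_toFinset _
  have hIB : I ⊆ B := by
    intro x hx
    rw [hIdef, Set.Finite.mem_toFinset] at hx
    exact_mod_cast hI₀.subset hx
  have hIcard : I.card = q := by
    have h := hI₀.encard_eq_eRk
    rw [hBq, ← hI₀fin.cast_ncard_eq] at h
    have h' : I₀.ncard = q := by exact_mod_cast h
    rw [hIdef, ← Set.ncard_eq_toFinset_card _ hI₀fin]; exact h'
  have hIind : M.Indep (I : Set α) := by rw [hIcoe]; exact hI₀.indep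
  have hBcl : (B : Set α) ⊆ M.closure (I : Set α) := by rw [hIcoe]; exact hI₀.subset_closure
  set X : Finset α := B \ I with hXdef
  have hXcard : X.card = B.card - q := by
    rw [hXdef, Finset.card_sdiff, Finset.inter_eq_left.2 hIB, hIcard]
  have hXI : ∀ x ∈ X, x ∉ I := fun x hx => (Finset.mem_sdiff.1 hx).2
  have hXB : ∀ x ∈ X, x ∈ B := fun x hx => (Finset.mem_sdiff.1 hx).1
  have hXcl : ∀ x ∈ X, x ∈ M.closure (I : Set α) := fun x hx => hBcl (by exact_mod_cast hXB x hx)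
  -- FAMILY 1: `I ∪ {x}`, `x ∈ X`
  set F₁ : Finset (Set α) := X.image (fun x => ((insert x I : Finset α) : Set α)) with hF₁
  have hF₁card : F₁.card = X.card := by
    rw [hF₁]
    apply Finset.card_image_of_injOn
    intro x hx y hy hxy
    have hxy'' : (insert x I : Finset α) = insert y I := by
      simp only at hxy
      exact Finset.coe_inj.1 hxy
    have hx' : x ∈ (insert y I : Finset α) := hxy'' ▸ Finset.mem_insert_self x I
    rcases Finset.mem_insert.1 hx' with h | h
    · exact h
    · exact absurd h (hXI x hx)
  have hF₁sub : F₁ ⊆ spanF M q B := by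
    intro D hD
    rw [hF₁, Finset.mem_image] at hD
    obtain ⟨x, hx, rfl⟩ := hD
    rw [mem_spanF]
    have hsubB : insert x I ⊆ B := Finset.insert_subset (hXB x hx) hIB
    have hcl : (B : Set α) ⊆ M.closure ((insert x I : Finset α) : Set α) := by
      refine hBcl.trans (M.closure_subset_closure ?_)
      rw [Finset.coe_insert]; exact Set.subset_insert x _
    refine ⟨insert x I, hsubB, ?_, ?_, hcl, rfl⟩
    · rw [Finset.card_insert_of_notMem (hXI x hx), hIcard]
    · exact eRk_eq_of_subset_of_subset_closure (by exact_mod_cast hsubB) hBq hcl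
  -- FAMILY 2: `(I ∖ {z}) ∪ P`, `P` a pair of `X`, `z ∈ I` on the fundamental circuit of an element of `P`
  set S : Finset (Σ _ : Finset α, α) :=
    (X.powersetCard 2).sigma (fun P => I.filter (fun z => ∃ x ∈ P, z ∈ M.fundCircuit x (I : Set α))) with hS
  set g : (Σ _ : Finset α, α) → Set α := fun s => ((s.1 ∪ I.erase s.2 : Finset α) : Set α) with hg
  set F₂ : Finset (Set α) := S.image g with hF₂
  have hSdata : ∀ s ∈ S, s.1 ⊆ X ∧ s.1.card = 2 ∧ s.2 ∈ I ∧
      ∃ x ∈ s.1, s.2 ∈ M.fundCircuit x (I : Set α) := by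
    intro s hs
    rw [hS, Finset.mem_sigma, Finset.mem_powersetCard, Finset.mem_filter] at hs
    exact ⟨hs.1.1, hs.1.2, hs.2.1, hs.2.2⟩
  -- `P ∪ I.erase z` determines `P = D ∖ I` and `z` = the element of `I` outside `D`
  have hsdiff : ∀ (P : Finset α) (z : α), P ⊆ X → (P ∪ I.erase z) \ I = P := by
    intro P z hPX
    ext a
    simp only [Finset.mem_sdiff, Finset.mem_union, Finset.mem_erase]
    constructor
    · rintro ⟨h1 | h1, h2⟩
      · exact h1
      · exact absurd h1.2 h2
    · intro ha
      exact ⟨Or.inl ha, hXI a (hPX ha)⟩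
  have hinter : ∀ (P : Finset α) (z : α), P ⊆ X → (P ∪ I.erase z) ∩ I = I.erase z := by
    intro P z hPX
    ext a
    simp only [Finset.mem_inter, Finset.mem_union, Finset.mem_erase]
    constructor
    · rintro ⟨h1 | h1, h2⟩
      · exact absurd h2 (hXI a (hPX h1))
      · exact h1
    · intro ha
      exact ⟨Or.inr ha, ha.2⟩
  have hF₂card : F₂.card = S.card := by
    rw [hF₂]
    apply Finset.card_image_of_injOn
    intro s hs s' hs' h
    obtain ⟨hP, -, hz, -⟩ := hSdata s (by exact_mod_cast hs)
    obtain ⟨hP', -, hz', -⟩ := hSdata s' (by exact_mod_cast hs')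
    have h' : (s.1 ∪ I.erase s.2 : Finset α) = s'.1 ∪ I.erase s'.2 := by
      have := h
      simp only [hg] at this
      exact_mod_cast this
    have hP1 : s.1 = s'.1 := by
      rw [← hsdiff s.1 s.2 hP, h', hsdiff s'.1 s'.2 hP']
    have hE : I.erase s.2 = I.erase s'.2 := by
      rw [← hinter s.1 s.2 hP, h', hinter s'.1 s'.2 hP']
    have hz1 : s.2 = s'.2 := by
      by_contra hne
      have hmem : s.2 ∈ I.erase s'.2 := Finset.mem_erase.2 ⟨hne, hz⟩
      rw [← hE] at hmem
      exact Finset.notMem_erase s.2 I hmem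
    exact Sigma.ext hP1 (heq_of_eq hz1)
  have hF₂sub : F₂ ⊆ spanF M q B := by
    intro D hD
    rw [hF₂, Finset.mem_image] at hD
    obtain ⟨s, hs, rfl⟩ := hD
    obtain ⟨hP, hP2, hz, x, hxP, hzC⟩ := hSdata s (by exact_mod_cast hs)
    have hxX : x ∈ X := hP hxP
    have hxI : x ∉ I := hXI x hxX
    have hxcl : x ∈ M.closure (I : Set α) := hXcl x hxX
    -- `z ∈ cl((I ∪ {x}) ∖ {z})`, so the closure of `(I ∪ {x}) ∖ {z}` is that of `I ∪ {x}`
    have hC : M.IsCircuit (M.fundCircuit x (I : Set α)) :=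
      hIind.fundCircuit_isCircuit hxcl (by simpa using hxI)
    have hCsub : M.fundCircuit x (I : Set α) ⊆ insert x (I : Set α) := M.fundCircuit_subset_insert x _
    have hzcl : s.2 ∈ M.closure ((insert x (I : Set α)) \ {s.2}) :=
      M.closure_subset_closure (Set.sdiff_subset_sdiff_left hCsub) (hC.mem_closure_sdiff_singleton_of_mem hzC)
    have hcleq : M.closure ((insert x (I : Set α)) \ {s.2}) = M.closure (insert x (I : Set α)) :=
      M.closure_sdiff_singleton_eq_closure hzcl
    have hsubD : (insert x (I : Set α)) \ {s.2} ⊆ ((s.1 ∪ I.erase s.2 : Finset α) : Set α) := by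
      intro a ha
      rw [Finset.coe_union, Finset.coe_erase]
      rcases ha.1 with h | h
      · exact Or.inl (by rw [h]; exact_mod_cast hxP)
      · exact Or.inr ⟨h, ha.2⟩
    have hcl : (B : Set α) ⊆ M.closure ((s.1 ∪ I.erase s.2 : Finset α) : Set α) := by
      calc (B : Set α) ⊆ M.closure (I : Set α) := hBcl
        _ ⊆ M.closure (insert x (I : Set α)) := M.closure_subset_closure (Set.subset_insert x _)
        _ = M.closure ((insert x (I : Set α)) \ {s.2}) := hcleq.symm
        _ ⊆ M.closure ((s.1 ∪ I.erase s.2 : Finset α) : Set α) := M.closure_subset_closure hsubD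
    have hsubB : s.1 ∪ I.erase s.2 ⊆ B :=
      Finset.union_subset (hP.trans (Finset.sdiff_subset)) ((Finset.erase_subset _ _).trans hIB)
    rw [mem_spanF]
    refine ⟨s.1 ∪ I.erase s.2, hsubB, ?_, ?_, hcl, rfl⟩
    · have hdisj : Disjoint s.1 (I.erase s.2) := by
        rw [Finset.disjoint_left]
        intro a ha ha'
        exact hXI a (hP ha) (Finset.mem_erase.1 ha').2
      rw [Finset.card_union_of_disjoint hdisj, hP2, Finset.card_erase_of_mem hz, hIcard]
      omega
    · exact eRk_eq_of_subset_of_subset_closure (by exact_mod_cast hsubB) hBq hcl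
  -- the two families are disjoint: family 1 contains `I`, family 2 misses `z ∈ I`
  have hdisj : Disjoint F₁ F₂ := by
    rw [Finset.disjoint_left]
    intro D hD1 hD2
    rw [hF₁, Finset.mem_image] at hD1
    rw [hF₂, Finset.mem_image] at hD2
    obtain ⟨x, hx, rfl⟩ := hD1
    obtain ⟨s, hs, hsD⟩ := hD2
    obtain ⟨hP, -, hz, -⟩ := hSdata s (by exact_mod_cast hs)
    have h' : (s.1 ∪ I.erase s.2 : Finset α) = insert x I := by
      have := hsD
      simp only [hg] at this
      exact_mod_cast this
    have hzmem : s.2 ∈ s.1 ∪ I.erase s.2 := by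
      rw [h']; exact Finset.mem_insert_of_mem hz
    rcases Finset.mem_union.1 hzmem with h | h
    · exact hXI _ (hP h) hz
    · exact Finset.notMem_erase s.2 I h
  -- counting: `#S ≥ 3·C(ν, 2)`
  have hIE : (I : Set α) ⊆ M.E := by rw [hIcoe]; exact hI₀.subset.trans hBE
  have hScard : 3 * (X.powersetCard 2).card ≤ S.card := by
    rw [hS, Finset.card_sigma]
    have : ∀ P ∈ X.powersetCard 2,
        3 ≤ (I.filter (fun z => ∃ x ∈ P, z ∈ M.fundCircuit x (I : Set α))).card := by
      intro P hP
      rw [Finset.mem_powersetCard] at hP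
      obtain ⟨x, y, hxy, rfl⟩ := Finset.card_eq_two.1 hP.2
      have hxX : x ∈ X := hP.1 (Finset.mem_insert_self x {y})
      have hyX : y ∈ X := hP.1 (Finset.mem_insert_of_mem (Finset.mem_singleton_self y))
      have h3 := three_le_card_filter_pair hcirc hC1 hIind hIE (hXcl x hxX) (hXI x hxX) (hXcl y hyX) (hXI y hyX)
        hxy (hBE (by exact_mod_cast hXB x hxX)) (hBE (by exact_mod_cast hXB y hyX))
      refine h3.trans (Finset.card_le_card ?_)
      intro z hz
      rw [Finset.mem_filter] at hz ⊢
      refine ⟨hz.1, ?_⟩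
      rcases hz.2 with h | h
      · exact ⟨x, Finset.mem_insert_self x {y}, h⟩
      · exact ⟨y, Finset.mem_insert_of_mem (Finset.mem_singleton_self y), h⟩
    calc 3 * (X.powersetCard 2).card = ∑ _P ∈ X.powersetCard 2, 3 := by
          simp [mul_comm]
      _ ≤ _ := Finset.sum_le_sum this
  have hpow : (X.powersetCard 2).card = X.card.choose 2 := Finset.card_powersetCard 2 X
  -- assemble
  have hunion : (F₁ ∪ F₂).card ≤ (spanF M q B).card :=
    Finset.card_le_card (Finset.union_subset hF₁sub hF₂sub)
  rw [Finset.card_union_of_disjoint hdisj, hF₁card, hF₂card] at hunion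
  rw [← hXcard]
  omega

end S2

end PercRepro
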